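import Mathlib
import HarnessLib
import Summits.HodgeConjecture.HodgeConjecture.Theorems.NikulinTwinTransportTwinTwistorTransportMukaiLiftDefs

/-!
# Crux `NikulinTwinTransport.TwinTwistorTransport` (stmt-HodgeConjecture-14393), line
# `mukai-lift-full-similitude`: audit lemma for the heart stubs `LiftCarrier` / `LiftTransport`

Lead c4 (prover-line-stmt-HodgeConjecture-14393-c4-0), wave 1.  The registered heart stubs of the checked
skeleton `Cruxes/TwinTwistorTransport/Lines/mukai_lift_full_similitude.lean` (reshape r8) quantify over a
CARRIER PACKAGE at the anchor `(X₀, X₀′)` one level up: a `μ_Ω`-stable vector bundle `G` on `X₀ ⊗ X₀′` whose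
class `κ₂(G) ∪ snd^*λ` (`κ₂ = ch₁² − 2r·ch₂`) acts on `H²` as `m • θ₀⁻¹ ∘ M̃ ∘ θ₀′` with `m ≠ 0`
(`LiftCarrier` asserts its existence, `LiftTransport` consumes it).  The lemma below is the kernel-checked
half of the audit "the package is not met by degenerate modules": whatever the Chern character `C`, the
correspondence class of a witness is NON-ZERO, because the action clause evaluated at `y = θ₀′⁻¹ δ`,
`δ = (0, 1) ∈ Λ_ℂ ⊕ ℂδ`, reads `[γ]_* y = m • θ₀⁻¹ (M̃ δ) = m • θ₀⁻¹ δ ≠ 0` (`liftEnd_delta`).  Hence the zero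
module, free modules and every module with `ch₁(G)² = 2r·ch₂(G)` (in particular every `G` of rank `≤ 1`
read with `r = 1`, by `ChernCharacterBetti.ch_of_hasRankLE_one`) are excluded: a witness is a genuine
rank `≥ 2` bundle, which the tree cannot construct and no cited source supplies for a `2`-similitude
between different `K3^{[n]}`-types (Markman 2024 Thm 1.1/1.5 and O'Grady arXiv:2606.03775 realise
ISOMETRIES only).  Worker lemma of the wave-1 `LiftTransport` audit, landed by the lead.
-/

-- `Summit.HodgeConjecture.HodgeConjecture.…` (summit = problem) duplicates a namespace component by design (D-0017).
set_option linter.dupNamespace false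
set_option autoImplicit false

noncomputable section

namespace Summit.HodgeConjecture.HodgeConjecture.Theorems.TwinTwistorTransport.MukaiLift

open CategoryTheory MonoidalCategory
open Literature.AlgebraicGeometry.Motives Literature.AlgebraicGeometry.HodgeTheory
open Literature.AlgebraicGeometry.Surfaces
open Literature.AlgebraicTopology.SingularHomology

/-- **No degenerate carrier at a Mukai-lift anchor.**  If a class `γ ∈ H⁸((X₀ ⊗ X₀′)(ℂ))` acts on `H²` as
`m • θ₀⁻¹ ∘ M̃ ∘ θ₀′` with `m ≠ 0` (the action clause of the carrier package of the registered stubs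
`LiftCarrier` / `LiftTransport`, for ANY `M`), then `γ ≠ 0`: at `y = θ₀′⁻¹(0, 1)` the right-hand side is
`m • θ₀⁻¹(0, 1) ≠ 0` (`liftEnd_delta`: the lift fixes `δ`), while the zero class acts by `0`.  So no module with
`ch₁(G)² − 2r·ch₂(G) = 0` — the zero module, a free module, a module of rank `≤ 1` read with `r = 1` — witnesses
the package. [folklore] -/
theorem corrClass_ne_zero_of_liftAction : ∀ {M : Module.End ℂ (K3Index → ℂ)} {μ : OrientationFamily} {X₀ X₀' : SchemeOver ℂ} {hX₀ : IsSmoothProjective (2 * 3) X₀} {hX₀' : IsSmoothProjective (2 * 2) X₀'} {θ₀ : complexBetti X₀ (2 * 1) ≃ₗ[ℂ] LiftLat} {θ₀' : complexBetti X₀' (2 * 1) ≃ₗ[ℂ] LiftLat} {γ : complexBetti (X₀ ⊗ X₀') (2 * (2 * 2))} {m : ℂ}, m ≠ 0 → (∀ y : complexBetti X₀' (2 * 1), corrH2 μ X₀ X₀' (2 * 3) (2 * 2) hX₀ hX₀' γ y = m • θ₀.symm (liftEnd M (θ₀' y))) → γ ≠ 0 := by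
  intro M μ X₀ X₀' hX₀ hX₀' θ₀ θ₀' γ m hm h
  rintro rfl
  have h1 := h (θ₀'.symm (0, 1))
  rw [LinearEquiv.apply_symm_apply, liftEnd_delta] at h1
  have h0 : corrH2 μ X₀ X₀' (2 * 3) (2 * 2) hX₀ hX₀' 0 (θ₀'.symm (0, 1)) = 0 := by
    simp only [corrH2, map_zero]
  rw [h0] at h1
  have hz : θ₀.symm (0, 1) = 0 := by
    have h2 := h1.symm
    rwa [smul_eq_zero, or_iff_right hm] at h2
  have h01 : ((0 : K3Index → ℂ), (1 : ℂ)) = (0 : LiftLat) := by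
    have e := congrArg θ₀ hz
    rw [LinearEquiv.apply_symm_apply, map_zero] at e
    exact e
  exact one_ne_zero (congrArg Prod.snd h01)

/-- **The action clause pins `m` uniquely**: two scalars `m`, `m′` satisfying the action clause for the same
class `γ` coincide (evaluate at `y = θ₀′⁻¹ δ` and cancel the non-zero vector `θ₀⁻¹ δ`).  So the `∃ m` of the
package carries no freedom beyond the class `γ` itself. [folklore] -/
theorem liftAction_scalar_unique : ∀ {M : Module.End ℂ (K3Index → ℂ)} {μ : OrientationFamily} {X₀ X₀' : SchemeOver ℂ} {hX₀ : IsSmoothProjective (2 * 3) X₀} {hX₀' : IsSmoothProjective (2 * 2) X₀'} {θ₀ : complexBetti X₀ (2 * 1) ≃ₗ[ℂ] LiftLat} {θ₀' : complexBetti X₀' (2 * 1) ≃ₗ[ℂ] LiftLat} {γ : complexBetti (X₀ ⊗ X₀') (2 * (2 * 2))} {m m' : ℂ}, (∀ y : complexBetti X₀' (2 * 1), corrH2 μ X₀ X₀' (2 * 3) (2 * 2) hX₀ hX₀' γ y = m • θ₀.symm (liftEnd M (θ₀' y))) → (∀ y : complexBetti X₀' (2 * 1), corrH2 μ X₀ X₀'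 (2 * 3) (2 * 2) hX₀ hX₀' γ y = m' • θ₀.symm (liftEnd M (θ₀' y))) → m = m' := by
  intro M μ X₀ X₀' hX₀ hX₀' θ₀ θ₀' γ m m' h h'
  have hδ : θ₀.symm ((0 : K3Index → ℂ), (1 : ℂ)) ≠ 0 := by
    intro hz
    have e := congrArg θ₀ hz
    rw [LinearEquiv.apply_symm_apply, map_zero] at e
    exact one_ne_zero (congrArg Prod.snd e)
  have h1 := h (θ₀'.symm (0, 1))
  have h2 := h' (θ₀'.symm (0, 1))
  rw [LinearEquiv.apply_symm_apply, liftEnd_delta] at h1 h2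
  rw [h1] at h2
  exact smul_left_injective ℂ hδ h2

end Summit.HodgeConjecture.HodgeConjecture.Theorems.TwinTwistorTransport.MukaiLift

end
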